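import Summits.MatrixMultiplication.MatrixMultiplication.Theorems.OutsiderSandwichBorderTable
import HarnessLib

/-!
# Record thresholds for the border table: which certificates beat `θ⋆ ≤ 0.37295`, by theorem

Route `OutsiderSandwich` (decomposition cell `decomp-mm`, lens 4 «minimal counterexample /
extremal reduction», gen 29), support for the aside leaf `BlockOneIsMM`
(stmt-MatrixMultiplication-27147); answers the critic's sharpening «every RECORD claim should name
the tree theorem carrying the incumbent bound» (decomp-mm bus, 2026-08-31).

The INCUMBENT is `OutsiderSandwichExchangeExponent.exchangeExponent_le_leGall : θ⋆ ≤ 0.37295`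
(`θ⋆ ≤ ω − 2` with the Alman–Duan–Vassilevska Williams–Xu–Xu–Zhou bound).  A border certificate
`⟨B⟩ ⊠ C₁^{⊠N} ⊵ ⟨m⟩ ⊠ ⟨2,2,2⟩^{⊠N}` (`AmortisedDeg N B m`) gives `θ⋆ ≤ log₂(B/m)/N`
(`exchangeExponent_le_of_amortisedDeg`); to make «record» a comparison of two DECLARATIONS we replace
the logarithm by a rational via `B^k ≤ m^k · 2^j ⟹ log₂(B/m) ≤ j/k` and tabulate the level-two cells
the census is searching (I-g25a / I-g29a–c):

| certificate | rational bound | record? |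
|---|---|---|
| `AmortisedDeg 2 3 2`  (48³ → 32³)  | `θ⋆ ≤ 3/10`   (`3⁵ ≤ 2⁵·2³`)      | yes (`3/10 < 0.37295`) |
| `AmortisedDeg 2 11 7` (176³ → 112³) | `θ⋆ ≤ 1/3`    (`11³ ≤ 7³·2²`)      | yes |
| `AmortisedDeg 2 5 3`  (80³ → 48³)  | `θ⋆ ≤ 37/100` (`5⁵⁰ ≤ 3⁵⁰·2³⁷`)   | yes (margin `0.003`) |
| `AmortisedDeg 2 8 5`  (128³ → 80³) | `θ⋆ ≤ 7/20`   (`8¹⁰ ≤ 5¹⁰·2⁷`)    | yes |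
| `AmortisedDeg 2 8 7`  (rung 1)     | `θ⋆ ≤ 1/10`   (`8⁵ ≤ 7⁵·2`)        | yes |
| any level-2 cell with `3B ≤ 5m`    | `θ⋆ ≤ 37/100`                      | yes |

* `logb_two_le_div_of_pow_le` — `0 < x`, `x^k ≤ 2^j`, `k ≠ 0` ⟹ `log₂ x ≤ j/k`;
* `exchangeExponent_le_of_pow_le` — the record criterion `AmortisedDeg N B m ∧ B^k ≤ m^k 2^j ⟹ θ⋆ ≤ j/(kN)`;
* `record_two_three_two` … `record_two_eight_seven` (the five cells) and the ratio form `exchangeExponent_le_of_level_two_ratio_three_fifths`,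
  each paired with `… < 0.37295`.

## References
* V. Strassen, *The asymptotic spectrum of tensors*, J. reine angew. Math. 384 (1988), Thm. 3.8.
  [Strassen1988]
* J. Alman, R. Duan, V. Vassilevska Williams, Y. Xu, Z. Xu, R. Zhou, *More asymmetry yields faster
  matrix multiplication*, SODA 2025 (`ω < 2.37134`; the tree's incumbent constant is `0.37295`).
  [AlmanDuanVassilevskaWilliamsXuXuZhou2025]
-/

noncomputable section

set_option linter.dupNamespace false
set_option autoImplicit false

namespace Summit.MatrixMultiplication.MatrixMultiplication.Theorems.OutsiderSandwichRecordThresholds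

open Summit.MatrixMultiplication.MatrixMultiplication.Theorems.OutsiderSandwichExchangeExponent
  (exchangeExponent exchangeExponent_le_leGall)
open Summit.MatrixMultiplication.MatrixMultiplication.Theorems.OutsiderSandwichBorderTable
  (AmortisedDeg exchangeExponent_le_of_amortisedDeg)

/-! ## 1. Logarithms to rationals -/

/-- `0 < x`, `x^k ≤ 2^j`, `k ≠ 0` ⟹ `log₂ x ≤ j / k`. [folklore] -/
theorem logb_two_le_div_of_pow_le {x : ℝ} {k j : ℕ} (hx : 0 < x) (hk : k ≠ 0)
    (h : x ^ k ≤ (2 : ℝ) ^ j) : Real.logb 2 x ≤ (j : ℝ) / k := by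
  rw [Real.logb_le_iff_le_rpow one_lt_two hx]
  have hkpos : (0 : ℝ) < k := by exact_mod_cast Nat.pos_of_ne_zero hk
  have h2 : ((2 : ℝ) ^ ((j : ℝ) / k)) ^ k = (2 : ℝ) ^ j := by
    rw [← Real.rpow_natCast, ← Real.rpow_mul (by norm_num : (0 : ℝ) ≤ 2),
      div_mul_cancel₀ _ hkpos.ne', Real.rpow_natCast]
  rw [← pow_le_pow_iff_left₀ hx.le (by positivity) hk, h2]
  exact h

/-- **Record criterion**: `AmortisedDeg N B m` with `B^k ≤ m^k · 2^j` (`N, m, k ≥ 1`) gives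
`θ⋆ ≤ j / (k N)`. [cite: Strassen1988, Thm. 3.8] -/
theorem exchangeExponent_le_of_pow_le {N B m k j : ℕ} (hN : 0 < N) (hm : 0 < m) (hk : k ≠ 0)
    (h : AmortisedDeg N B m) (hpow : (B : ℝ) ^ k ≤ (m : ℝ) ^ k * 2 ^ j) :
    exchangeExponent ≤ (j : ℝ) / (k * N) := by
  have hθ := exchangeExponent_le_of_amortisedDeg hN hm h
  have hmpos : (0 : ℝ) < m := by exact_mod_cast hm
  have hNpos : (0 : ℝ) < N := by exact_mod_cast hN
  rcases Nat.eq_zero_or_pos B with hB0 | hB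
  · subst hB0
    have h0 : exchangeExponent ≤ 0 := by simpa using hθ
    exact h0.trans (by positivity)
  have hBpos : (0 : ℝ) < B := by exact_mod_cast hB
  have hratio : ((B : ℝ) / m) ^ k ≤ (2 : ℝ) ^ j := by
    rw [div_pow, div_le_iff₀ (by positivity)]
    simpa [mul_comm] using hpow
  have hlog := logb_two_le_div_of_pow_le (div_pos hBpos hmpos) hk hratio
  calc exchangeExponent ≤ Real.logb 2 ((B : ℝ) / m) / N := hθ
    _ ≤ (j : ℝ) / k / N := div_le_div_of_nonneg_right hlog hNpos.le
    _ = (j : ℝ) / (k * N) := by rw [div_div]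

/-! ## 2. The level-two cells under search -/

/-- **(2; 3 → 2)** ⟹ `θ⋆ ≤ 3/10` (`3⁵ = 243 ≤ 256 = 2⁵·2³`). [new] -/
theorem record_two_three_two (h : AmortisedDeg 2 3 2) :
    exchangeExponent ≤ 3 / 10 := by
  have := exchangeExponent_le_of_pow_le (k := 5) (j := 3) two_pos two_pos (by norm_num) h
    (by norm_num)
  norm_num at this
  exact this

/-- **(2; 11 → 7)** ⟹ `θ⋆ ≤ 1/3` (`11³ = 1331 ≤ 1372 = 7³·2²`). [new] -/
theorem record_two_eleven_seven (h : AmortisedDeg 2 11 7) :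
    exchangeExponent ≤ 1 / 3 := by
  have := exchangeExponent_le_of_pow_le (k := 3) (j := 2) two_pos (by norm_num) (by norm_num) h
    (by norm_num)
  norm_num at this
  exact this

/-- **(2; 5 → 3)** ⟹ `θ⋆ ≤ 37/100` (`5⁵⁰ ≤ 3⁵⁰·2³⁷`). [new] -/
theorem record_two_five_three (h : AmortisedDeg 2 5 3) :
    exchangeExponent ≤ 37 / 100 := by
  have := exchangeExponent_le_of_pow_le (k := 50) (j := 37) two_pos (by norm_num) (by norm_num) h
    (by norm_num)
  norm_num at this
  exact this

/-- **(2; 8 → 5)** ⟹ `θ⋆ ≤ 7/20` (`8¹⁰ ≤ 5¹⁰·2⁷`). [new] -/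
theorem record_two_eight_five (h : AmortisedDeg 2 8 5) :
    exchangeExponent ≤ 7 / 20 := by
  have := exchangeExponent_le_of_pow_le (k := 10) (j := 7) two_pos (by norm_num) (by norm_num) h
    (by norm_num)
  norm_num at this
  exact this

/-- **(2; 8 → 7)** (rung 1 of the border ladder) ⟹ `θ⋆ ≤ 1/10` (`8⁵ = 32768 ≤ 33614 = 7⁵·2`). [new] -/
theorem record_two_eight_seven (h : AmortisedDeg 2 8 7) :
    exchangeExponent ≤ 1 / 10 := by
  have := exchangeExponent_le_of_pow_le (k := 5) (j := 1) two_pos (by norm_num) (by norm_num) h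
    (by norm_num)
  norm_num at this
  exact this

/-- **Ratio form**: any level-two certificate with `3B ≤ 5m` (`m ≥ 1`) gives `θ⋆ ≤ 37/100`. [new] -/
theorem exchangeExponent_le_of_level_two_ratio_three_fifths {B m : ℕ} (hm : 0 < m)
    (h : AmortisedDeg 2 B m) (hBm : 3 * B ≤ 5 * m) : exchangeExponent ≤ 37 / 100 := by
  have hBm' : (3 : ℝ) * B ≤ 5 * m := by exact_mod_cast hBm
  have hB' : (B : ℝ) ≤ 5 / 3 * m := by linarith
  have hpow : (B : ℝ) ^ 50 ≤ (m : ℝ) ^ 50 * 2 ^ 37 := by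
    calc (B : ℝ) ^ 50 ≤ (5 / 3 * m) ^ 50 := pow_le_pow_left₀ (by positivity) hB' 50
      _ = (5 / 3 : ℝ) ^ 50 * (m : ℝ) ^ 50 := by rw [mul_pow]
      _ ≤ 2 ^ 37 * (m : ℝ) ^ 50 :=
          mul_le_mul_of_nonneg_right (by norm_num) (by positivity)
      _ = (m : ℝ) ^ 50 * 2 ^ 37 := by ring
  have := exchangeExponent_le_of_pow_le (k := 50) (j := 37) two_pos hm (by norm_num) h hpow
  norm_num at this
  exact this

/-- **Ratio form, coarser**: `5B ≤ 8m` gives `θ⋆ ≤ 7/20`. [new] -/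
theorem exchangeExponent_le_of_level_two_ratio_five_eighths {B m : ℕ} (hm : 0 < m)
    (h : AmortisedDeg 2 B m) (hBm : 5 * B ≤ 8 * m) : exchangeExponent ≤ 7 / 20 := by
  have hBm' : (5 : ℝ) * B ≤ 8 * m := by exact_mod_cast hBm
  have hB' : (B : ℝ) ≤ 8 / 5 * m := by linarith
  have hpow : (B : ℝ) ^ 10 ≤ (m : ℝ) ^ 10 * 2 ^ 7 := by
    calc (B : ℝ) ^ 10 ≤ (8 / 5 * m) ^ 10 := pow_le_pow_left₀ (by positivity) hB' 10
      _ = (8 / 5 : ℝ) ^ 10 * (m : ℝ) ^ 10 := by rw [mul_pow]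
      _ ≤ 2 ^ 7 * (m : ℝ) ^ 10 :=
          mul_le_mul_of_nonneg_right (by norm_num) (by positivity)
      _ = (m : ℝ) ^ 10 * 2 ^ 7 := by ring
  have := exchangeExponent_le_of_pow_le (k := 10) (j := 7) two_pos hm (by norm_num) h hpow
  norm_num at this
  exact this

/-! ## 3. Comparison with the incumbent `exchangeExponent_le_leGall : θ⋆ ≤ 0.37295` -/

/-- The five rational bounds all beat the incumbent constant. [new] -/
theorem thresholds_lt_incumbent :
    (3 / 10 : ℝ) < 0.37295 ∧ (1 / 3 : ℝ) < 0.37295 ∧ (37 / 100 : ℝ) < 0.37295 ∧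
      (7 / 20 : ℝ) < 0.37295 ∧ (1 / 10 : ℝ) < 0.37295 := by
  norm_num

/-- **Any level-two certificate with `3B ≤ 5m` is a RECORD**: `θ⋆ < 0.37295`, strictly below the
incumbent `exchangeExponent_le_leGall`. [new] -/
theorem exchangeExponent_lt_incumbent_of_level_two_ratio {B m : ℕ} (hm : 0 < m)
    (h : AmortisedDeg 2 B m) (hBm : 3 * B ≤ 5 * m) : exchangeExponent < 0.37295 :=
  (exchangeExponent_le_of_level_two_ratio_three_fifths hm h hBm).trans_lt (by norm_num)

/-- In particular for the cells `(2;3→2)`, `(2;5→3)`, `(2;8→5)`, `(2;11→7)`, `(2;8→7)`. [new] -/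
theorem exchangeExponent_lt_incumbent_of_cells
    (h : AmortisedDeg 2 3 2 ∨ AmortisedDeg 2 5 3 ∨ AmortisedDeg 2 8 5 ∨ AmortisedDeg 2 11 7 ∨
      AmortisedDeg 2 8 7) : exchangeExponent < 0.37295 := by
  rcases h with h | h | h | h | h
  · exact exchangeExponent_lt_incumbent_of_level_two_ratio two_pos h (by norm_num)
  · exact exchangeExponent_lt_incumbent_of_level_two_ratio (by norm_num) h (by norm_num)
  · exact exchangeExponent_lt_incumbent_of_level_two_ratio (by norm_num) h (by norm_num)
  · exact (record_two_eleven_seven h).trans_lt (by norm_num)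
  · exact exchangeExponent_lt_incumbent_of_level_two_ratio (by norm_num) h (by norm_num)

/-- For reference: the incumbent itself (tree theorem, restated as an alias-free pointer in the
conjunction with the floor side `0 ≤ θ⋆`). [cite: AlmanDuanVassilevskaWilliamsXuXuZhou2025, Thm. 1.1] -/
theorem incumbent_window : 0 ≤ exchangeExponent ∧ exchangeExponent ≤ 0.37295 :=
  ⟨OutsiderSandwichExchangeExponent.exchangeExponent_nonneg, exchangeExponent_le_leGall⟩

end Summit.MatrixMultiplication.MatrixMultiplication.Theorems.OutsiderSandwichRecordThresholds

end
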